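import Summits.Ventures.PercRepro.ProfilePointedCircuitClassesStarNineTwelve
import Summits.Ventures.PercRepro.ProfilePointedCircuitClassesStarSharpM

/-!
# PercRepro — THE DOUBLE SERIES PAIR REGIME OF THE TWELVE-POINT STATEMENT WITH A SECOND 4-CIRCUIT THROUGH `a, b`
(p5, gen 57; `proofs/P5-GM1.md` §85 (f))

An instance of `inCount_five_le_outCount_six_of_two_seriesPairs_of_reduce` stated on `N` itself: two series pairs
`{a, a′}`, `{b, b′}` on a common 4-circuit, `e` outside, no further series pair through `b′`, and two more points `x, y`
with `ρ{a, b, x} = ρ{a, b, y} = 3` and `ρ{a, b, x, y} = 3` (a second rank-3 quadruple through `a, b`).  In the nine-point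
minor `N₉ = N ／ {a, b} ∖ b′` the points `x, y` become a PARALLEL PAIR (`ρ_{N₉}(S) = ρ_N(S + a + b) − 2`), and `N₉` is
coloop-free (`rk_erase_minor_eq_of_seriesPair` on `N ／ a`), so the parallel-pair regime of `StarNine` supplies the
(★)₉ instance: `inCount_five_le_outCount_six_of_two_seriesPairs_of_four_circuit`.
-/

open scoped Matroid

namespace PercRepro.Cogirth

open Finset ThmH Skew Shadow Profile

open Classical

variable {α : Type} [DecidableEq α] {N : Matroid α} [N.Finite]

section StarNineTwelveB

/-- **THE RANK OF A SUBSET OF `N ／ {a, b} ∖ b′`**: for `{a, b}` independent and `X ⊆ E − a − b − b′`,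
`ρ_{N₉}(X) + 2 = ρ_N(X + a + b)`. -/
theorem rk_double_minor_add_two {a b b' : α} (ha : a ∈ gr N) (hb : b ∈ gr N) (hab : a ≠ b)
    (hrab : rk N {a, b} = 2) {X : Finset α} (hX : X ⊆ (((gr N).erase a).erase b).erase b') :
    rk (((N ／ ({a} : Set α)) ／ ({b} : Set α)) ＼ ({b'} : Set α)) X + 2 = rk N (insert a (insert b X)) := by
  have hra : rk N {a} = 1 := by
    have h1 := rk_le_card (M := N) {a}
    rw [card_singleton] at h1
    have h2 := rk_insert_eq hb (singleton_subset_iff.2 ha) (M := N)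
    rw [pair_comm] at hrab
    split_ifs at h2 <;> omega
  have hinda : N.Indep ({a} : Set α) := by
    have := indep_of_rk_eq_card' (M := N) (X := {a}) (by rw [hra, card_singleton]); simpa using this
  have hgr1 : gr (N ／ ({a} : Set α)) = (gr N).erase a := gr_contract'
  have hbg1 : b ∈ gr (N ／ ({a} : Set α)) := by rw [hgr1]; exact mem_erase.2 ⟨hab.symm, hb⟩
  have hrb1 : rk (N ／ ({a} : Set α)) {b} = 1 := by
    have h := rk_contract_add_one hinda (X := {b}) (by rw [singleton_subset_iff]; exact mem_erase.2 ⟨hab.symm, hb⟩)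
    rw [hrab] at h; omega
  have hindb : (N ／ ({a} : Set α)).Indep ({b} : Set α) := by
    have := indep_of_rk_eq_card' (M := N ／ ({a} : Set α)) (X := {b}) (by rw [hrb1, card_singleton]); simpa using this
  have hgr2 : gr ((N ／ ({a} : Set α)) ／ ({b} : Set α)) = ((gr N).erase a).erase b := by rw [gr_contract', hgr1]
  have hX2 : X ⊆ (gr ((N ／ ({a} : Set α)) ／ ({b} : Set α))).erase b' := by rw [hgr2]; exact hX
  have hX1 : X ⊆ (gr (N ／ ({a} : Set α))).erase b := by
    rw [hgr1]; exact hX.trans (erase_subset _ _)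
  have hX0 : insert b X ⊆ (gr N).erase a := by
    rw [insert_subset_iff]
    exact ⟨mem_erase.2 ⟨hab.symm, hb⟩, hX.trans ((erase_subset _ _).trans (erase_subset _ _))⟩
  rw [rk_delete hX2]
  have h1 := rk_contract_add_one hindb hX1
  have h2 := rk_contract_add_one hinda hX0
  omega

/-- **THE DOUBLE SERIES PAIR REGIME WITH A SECOND RANK-3 QUADRUPLE THROUGH `a, b`**: on `#E = 12`, `ρ(E) = 7`,
coloop-free, with series pairs `{a, a′}`, `{b, b′}` on a common 4-circuit, no further series pair through `b′`, `e`
outside the pairs and `x ≠ y` outside them with `ρ{a, b, x} = ρ{a, b, y} = 3 = ρ{a, b, x, y}`, `in_5(e) ≤ out_6(e)`. -/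
theorem inCount_five_le_outCount_six_of_two_seriesPairs_of_four_circuit (hn : (gr N).card = 12)
    (hR : rk N (gr N) = 7) (hcf : ∀ z ∈ gr N, rk N ((gr N).erase z) = 7) {a a' b b' e x y : α}
    (h : SeriesPair N a a') (h' : SeriesPair N b b') (hab : a ≠ b) (hab' : a ≠ b') (ha'b : a' ≠ b)
    (ha'b' : a' ≠ b') (hcirc : rk N {a, a', b, b'} = 3) (hno : ∀ z ∈ gr N, z ≠ b → ¬ SeriesPair N b' z)
    (he : e ∈ gr N) (hea : e ≠ a) (hea' : e ≠ a') (heb : e ≠ b) (heb' : e ≠ b') (hx : x ∈ gr N) (hy : y ∈ gr N)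
    (hxy : x ≠ y) (hxa : x ≠ a) (hxb : x ≠ b) (hxb' : x ≠ b') (hya : y ≠ a) (hyb : y ≠ b) (hyb' : y ≠ b')
    (hrx : rk N {a, b, x} = 3) (hry : rk N {a, b, y} = 3) (hrxy : rk N {a, b, x, y} = 3) :
    inCount N 5 e ≤ outCount N 6 e := by
  have ha : a ∈ gr N := h.1
  have hb : b ∈ gr N := h'.1
  have hb'g : b' ∈ gr N := h'.2.1
  have hbb' : b ≠ b' := h'.2.2.1
  have hinda := indep_singleton_of_seriesPair h
  have hgr1 : gr (N ／ ({a} : Set α)) = (gr N).erase a := gr_contract'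
  have hser' : SeriesPair (N ／ ({a} : Set α)) b b' := seriesPair_contract_of_ne h' ha hab hab' hinda
  have hgr9 : gr (((N ／ ({a} : Set α)) ／ ({b} : Set α)) ＼ ({b'} : Set α)) = (((gr N).erase a).erase b).erase b' := by
    rw [gr_minor_of_seriesPair, hgr1]
  -- `{a, b}` is independent
  have hrab : rk N {a, b} = 2 := by
    have h1 := rk_le_card (M := N) {a, b}
    rw [card_pair hab] at h1
    have h2 := rk_insert_eq hx (insert_subset ha (singleton_subset_iff.2 hb)) (M := N)
    have e1 : insert x ({a, b} : Finset α) = {a, b, x} := by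
      ext z; simp only [mem_insert, mem_singleton]; tauto
    rw [e1, hrx] at h2
    split_ifs at h2 <;> omega
  -- `x, y` in the minor, with `ρ{x} = ρ{y} = 1` and `y ∈ cl{x}`
  have hx9 : x ∈ gr (((N ／ ({a} : Set α)) ／ ({b} : Set α)) ＼ ({b'} : Set α)) := by
    rw [hgr9]; exact mem_erase.2 ⟨hxb', mem_erase.2 ⟨hxb, mem_erase.2 ⟨hxa, hx⟩⟩⟩
  have hy9 : y ∈ gr (((N ／ ({a} : Set α)) ／ ({b} : Set α)) ＼ ({b'} : Set α)) := by
    rw [hgr9]; exact mem_erase.2 ⟨hyb', mem_erase.2 ⟨hyb, mem_erase.2 ⟨hya, hy⟩⟩⟩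
  have hrx9 : rk (((N ／ ({a} : Set α)) ／ ({b} : Set α)) ＼ ({b'} : Set α)) {x} = 1 := by
    have h1 := rk_double_minor_add_two ha hb hab hrab (X := {x}) (by rw [singleton_subset_iff, ← hgr9]; exact hx9)
    have e1 : insert a (insert b ({x} : Finset α)) = {a, b, x} := rfl
    rw [e1, hrx] at h1; omega
  have hry9 : rk (((N ／ ({a} : Set α)) ／ ({b} : Set α)) ＼ ({b'} : Set α)) {y} = 1 := by
    have h1 := rk_double_minor_add_two ha hb hab hrab (X := {y}) (by rw [singleton_subset_iff, ← hgr9]; exact hy9)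
    have e1 : insert a (insert b ({y} : Finset α)) = {a, b, y} := rfl
    rw [e1, hry] at h1; omega
  have hcl9 : y ∈ clF (((N ／ ({a} : Set α)) ／ ({b} : Set α)) ＼ ({b'} : Set α)) {x} := by
    rw [mem_clF_iff_rk_insert hy9 (singleton_subset_iff.2 hx9), hrx9]
    have h1 := rk_double_minor_add_two ha hb hab hrab (X := insert y {x}) (by
      rw [insert_subset_iff, singleton_subset_iff, ← hgr9]; exact ⟨hy9, hx9⟩)
    have e1 : insert a (insert b (insert y ({x} : Finset α))) = {a, b, x, y} := by
      ext z; simp only [mem_insert, mem_singleton]; tauto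
    rw [e1, hrxy] at h1; omega
  -- the minor is coloop-free
  have hcf' : ∀ z ∈ gr (N ／ ({a} : Set α)),
      rk (N ／ ({a} : Set α)) ((gr (N ／ ({a} : Set α))).erase z) = rk (N ／ ({a} : Set α)) (gr (N ／ ({a} : Set α))) := by
    intro z hz
    rw [hgr1] at hz ⊢
    have hza : z ≠ a := (mem_erase.1 hz).1
    have hzg : z ∈ gr N := (mem_erase.1 hz).2
    have h1 := rk_contract_add_one hinda (X := ((gr N).erase a).erase z) (erase_subset _ _)
    have e1 : insert a (((gr N).erase a).erase z) = (gr N).erase z := by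
      rw [erase_right_comm, insert_erase (mem_erase.2 ⟨hza.symm, ha⟩)]
    rw [e1, hcf z hzg] at h1
    have h2 := rk_gr_contract_add_one hinda ha
    rw [hgr1, hR] at h2
    omega
  have hno' : ∀ z ∈ gr (N ／ ({a} : Set α)), z ≠ b → ¬ SeriesPair (N ／ ({a} : Set α)) b' z := by
    intro z hz hzb hp
    rw [hgr1] at hz
    have hza : z ≠ a := (mem_erase.1 hz).1
    exact hno z (mem_erase.1 hz).2 hzb (seriesPair_of_seriesPair_contract ha hinda hab' hza.symm hp)
  have hR9 : rk (((N ／ ({a} : Set α)) ／ ({b} : Set α)) ＼ ({b'} : Set α))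
      (gr (((N ／ ({a} : Set α)) ／ ({b} : Set α)) ＼ ({b'} : Set α))) = 5 := by
    have h1 := rk_gr_minor_add_one_of_seriesPair hser'
    have h2 := rk_gr_contract_add_one hinda ha
    rw [hR] at h2
    omega
  have hcf9 : ∀ z ∈ gr (((N ／ ({a} : Set α)) ／ ({b} : Set α)) ＼ ({b'} : Set α)),
      rk (((N ／ ({a} : Set α)) ／ ({b} : Set α)) ＼ ({b'} : Set α))
        ((gr (((N ／ ({a} : Set α)) ／ ({b} : Set α)) ＼ ({b'} : Set α))).erase z) = 5 := by
    intro z hz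
    rw [rk_erase_minor_eq_of_seriesPair hser' hcf' hno' z hz, hR9]
  exact inCount_five_le_outCount_six_of_two_seriesPairs_of_reduce hn hR h h' hab hab' ha'b ha'b' hcirc he hea hea'
    heb heb' hcf9 (Or.inr (Or.inl ⟨x, hx9, y, hy9, hxy, hrx9, hry9, hcl9⟩))

end StarNineTwelveB

end PercRepro.Cogirth
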